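import Summits.BirchSwinnertonDyer.BirchSwinnertonDyer.Theorems.KolyvaginDepthDoorMSymbolCert997c1Twist
import Summits.BirchSwinnertonDyer.BirchSwinnertonDyer.Theorems.KolyvaginDepthDoorMSymbolCert997c1K
import Summits.BirchSwinnertonDyer.BirchSwinnertonDyer.Theorems.KolyvaginDepthDoorDepthTableKuriharaRow389a1CertifiedT
import Summits.BirchSwinnertonDyer.BirchSwinnertonDyer.Theorems.KolyvaginDepthDoorDepthTableKuriharaRow997c1CertifiedE
import Summits.BirchSwinnertonDyer.BirchSwinnertonDyer.Theorems.KolyvaginDepthDoorDepthTableKuriharaDecisive997c1Neg23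
import Literature.NumberTheory.EllipticCurves.BurungaleSkinnerTianWan2024.CyclotomicPConverseOverQProofs
import HarnessLib

/-!
# Route `KolyvaginDepthDoor`, crux `KolyvaginDepthSupplyKN` (stmt-BirchSwinnertonDyer-22820) —
# DEPTH TABLE v28: row `997c1` @ `(7, −23)` with BOTH Kurihara claims PROVED (no computational claim left)

Helper file of the lead prover of line `levelone` (kdd-p1 g33; `--supports stmt-BirchSwinnertonDyer-22820
--as helper`); it closes nothing and BSD is NOT proved by it. Sibling of `…KuriharaRow709a1CertifiedT` (v27) for the
rank-two row `997c1` at the Heegner field `ℚ(√−23)`: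
* §1 the Kurihara data of `T₀ = 997c1 ⊗ χ₋₂₃` at `(7, 239)` — `239` the decisive Kolyvagin prime of the row (logarithm table mod `239`
  of `…MSymbolCert997c1K`; the twisted minus sums `sigmaT` of `…MSymbolCert997c1Twist`; `kSumT ≢ 0 (mod 7)` by `decide`);
* §2 `exists_kuriharaNumber_ne_zero_T0`: for every parametrisation datum of `T₀` at level `527413` the Kurihara
  number at `(7, 239)` is non-zero — the line `[r]⁺_g ∈ C ℤ` through `1/2` (`exists_mul_eq_half`) and the
  integrality of `[1/239]⁺_g = (1) C` (`T₀[7]` irreducible, transported from `997c1` through the twist) make `C`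
  a `7`-adic unit (`kuriharaNumber_ne_zero_of_const`);
* §3 `C997c1.kuriharaClaimT_7_239` — the twist-side Kurihara claim (the hypothesis `hunit` of g24's
  `C997c1.cruxBody_of_unit_239`) VERBATIM, from modularity by name; `C997c1.cruxBody_of_print_7_neg23` — the row with both
  claims discharged (`C997c1.kuriharaClaim_7_10277` is the kernel-certified E-side, v27), conditional on the four print facts only.

References: [Kim2022StructureSelmer] Thm. 1.11, §1.4.3; [MazurTateTeitelbaum1986Invent] §I.8; [CremonaAlgorithms1997]
§2.8, Table 1 (997c1); [WZhang2014] L8.4 (1), Thm. 9.1; [Mazur1978] Cor. 4.1.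
-/

set_option linter.dupNamespace false

noncomputable section

open scoped MatrixGroups ModularForm Classical NumberField
open CongruenceSubgroup
open Literature.NumberTheory.EllipticCurves Literature.NumberTheory.EllipticCurves.ModularForms
open Literature.NumberTheory.EllipticCurves.BurungaleSkinnerTianWan2024
  (hasIrreducibleModPGaloisRep_of_smul_eq_quadraticTwist)
open Summit.BirchSwinnertonDyer.BirchSwinnertonDyer.Rank2Observatory
open Summit.BirchSwinnertonDyer.BirchSwinnertonDyer.Theorems.KolyvaginDepthDoor.MSymbolCert.Cert389a1
  (exists_mul_eq_half kuriharaNumber_ne_zero_of_const)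

namespace Summit.BirchSwinnertonDyer.BirchSwinnertonDyer.Theorems.KolyvaginDepthDoor.MSymbolCert.Cert997c1

/-! ## §1 The Kurihara data of `T₀` at `(7, 239)` -/

/-- The table family for `n = 239` (the logarithm table `tab239` of the E-side record, `…MSymbolCert997c1K`). [folklore] -/
def T239 (ℓ : ℕ) : List ℕ := if ℓ = 239 then tab239 else []

/-- Admissibility of the table family. [folklore] -/
theorem T239_ok : ∀ ℓ, T239 ℓ = [] ∨ (ℓ.Prime ∧ tabOK ℓ 7 (T239 ℓ) = true) := by
  intro ℓ
  by_cases h : ℓ = 239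
  · right
    rw [h, T239, if_pos rfl]
    exact ⟨by norm_num, tabOK_239⟩
  · left; simp [T239, h]

/-- Surjectivity at the prime factors of `239`. [folklore] -/
theorem T239_surj : ∀ ℓ ∈ (239 : ℕ).primeFactors, tabSurj ℓ 7 (T239 ℓ) = true := by
  rw [show (239 : ℕ).primeFactors = {239} from Nat.Prime.primeFactors (by norm_num)]
  intro ℓ hℓ
  rw [Finset.mem_singleton] at hℓ
  rw [hℓ, T239, if_pos rfl]
  exact tabSurj_239

/-- The unit witness `sigmaT 1 = 1` (decide). [folklore] -/
theorem sigmaT_witness : sigmaT 1 = 1 := by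
  decide +kernel

set_option maxHeartbeats 4000000 in
/-- **The twisted Kurihara sum is `≢ 0 (mod 7)`** (decide in 4 chunks: `≡ 1`).
[cite: Kim2022StructureSelmer, §1.4.3] -/
theorem kSumT_ne_zero : kSum 7 239 sigmaT (239 : ℕ).primeFactors T239 ≠ 0 := by
  rw [show (239 : ℕ).primeFactors = {239} from Nat.Prime.primeFactors (by norm_num), kSum, sum_range_eq_of_chunks4 _ 239 60 60 60 59 rfl ((1 : ℕ) : ZMod 7) ((3 : ℕ) : ZMod 7) ((3 : ℕ) : ZMod 7) ((1 : ℕ) : ZMod 7) ?h0 ?h1 ?h2 ?h3]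
  · decide
  · decide +kernel
  · decide +kernel
  · decide +kernel
  · decide +kernel

/-! ## §2 The Kurihara number of the newform of `T₀` -/

/-- **`δ̃_{239}(T₀) ≢ 0 (mod 7)` from modularity of `997c1` by name.** For every modular parametrisation datum
`D` of `T₀` at a level equal to `527413`: the table logarithm `ψ` is surjective and `kuriharaNumber D.f 7 239 ψ ≠ 0`. [cite: Kim2022StructureSelmer, §1.4.3] [cite: MazurTateTeitelbaum1986Invent, §I.8] -/
theorem exists_kuriharaNumber_ne_zero_T0 (hnf : exists_isNewformOf) (N : ℕ) (hN : N = 527413) [NeZero N]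
    (D : haveI := C997c1.minTwist23_isElliptic; ModularParametrizationData T0 N) :
    ∃ ψ : (ℓ : ℕ) → (ZMod ℓ)ˣ →* Multiplicative (ZMod 7),
      (∀ ℓ ∈ (239 : ℕ).primeFactors, Function.Surjective (ψ ℓ)) ∧ kuriharaNumber D.f 7 239 ψ ≠ 0 := by
  subst hN
  haveI := C997c1.minTwist23_isElliptic
  haveI := C997c1.minTwist23_isGloballyMinimal
  haveI := isElliptic_c997c1
  haveI := isGloballyMinimal_c997c1
  haveI : Fact (Nat.Prime 7) := ⟨by norm_num⟩
  haveI : NeZero (239 : ℕ) := ⟨by norm_num⟩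
  have hg := D.isNewformOf
  obtain ⟨C, hCall, hCval⟩ := exists_const_T0 hnf D.f hg
  -- `|C|₇ ≥ 1`: `C k = 1/2`
  obtain ⟨k, hk⟩ := exists_mul_eq_half D.f hg.1 hg.coeffField_eq_bot hCall
  -- `|C|₇ ≤ 1`: integrality at `1/239`, `sigmaT 1 = 1`; `T₀[7]` irreducible, transported through the twist
  have hirrE : (((⟨0, -1, 1, -24, 54⟩ : WeierstrassCurve ℤ).map (Int.castRingHom ℚ))).HasIrreducibleModPGaloisRep 7 :=
    hasIrreducibleModPGaloisRep_of_hasSurjectiveModNGaloisRep _ 7 C997c1.hasSurjectiveModNGaloisRep_7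
  have hirr : T0.HasIrreducibleModPGaloisRep 7 :=
    hasIrreducibleModPGaloisRep_of_smul_eq_quadraticTwist (((⟨0, -1, 1, -24, 54⟩ : WeierstrassCurve ℤ).map (Int.castRingHom ℚ))) T0 7 (d := -23) (by norm_num)
      C997c1.minTwist23_smul_eq hirrE
  have hle : ‖((ratPlusSymbol D.f (((1 : ℕ) : ℚ) / 239) : ℚ) : ℚ_[7])‖ ≤ 1 := by
    refine IsNewformOf.norm_ratPlusSymbol_le_one hg (by norm_num) hirr ?_
    have hden : (((1 : ℕ) : ℚ) / 239).den = 239 := by norm_num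
    rw [hden]; norm_num
  rw [hCval 1 (by norm_num) (by norm_num), sigmaT_witness] at hle
  -- hence `|C|₇ = 1`
  have h2 : ‖(2 : ℚ_[7])‖ = 1 := by
    have := (Padic.norm_natCast_eq_one_iff (p := 7) (n := 2)).mpr (by norm_num)
    simpa using this
  have hv : ‖(((1 : ℤ) : ℚ) : ℚ_[7])‖ = 1 := by
    rw [Rat.cast_intCast]
    refine le_antisymm (Padic.norm_int_le_one _) (not_lt.mp fun hlt => ?_)
    exact absurd (Padic.norm_intCast_lt_one_iff.mp hlt) (by norm_num)
  have hle' : ‖(C : ℚ_[7])‖ ≤ 1 := by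
    have e : ((C * ((1 : ℤ) : ℚ) : ℚ) : ℚ_[7]) = (C : ℚ_[7]) * (((1 : ℤ) : ℚ) : ℚ_[7]) := by push_cast; ring
    rw [e, norm_mul, hv, mul_one] at hle
    exact hle
  have hk1 : ‖((k : ℤ) : ℚ_[7])‖ ≤ 1 := Padic.norm_int_le_one k
  have hprod : ‖(C : ℚ_[7])‖ * ‖((k : ℤ) : ℚ_[7])‖ = 1 := by
    have e : ((C * k : ℚ) : ℚ_[7]) = (C : ℚ_[7]) * ((k : ℤ) : ℚ_[7]) := by push_cast; ring
    rw [← norm_mul, ← e, hk]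
    push_cast
    rw [norm_div, norm_one, h2]; norm_num
  have hC7 : ‖(C : ℚ_[7])‖ = 1 := by
    apply le_antisymm hle'
    nlinarith [norm_nonneg (C : ℚ_[7]), norm_nonneg ((k : ℤ) : ℚ_[7])]
  -- so numerator and denominator of `C` are prime to `7`
  have hCq : (C : ℚ_[7]) = ((C.num : ℤ) : ℚ_[7]) / ((C.den : ℕ) : ℚ_[7]) := by
    rw [← Rat.cast_intCast, ← Rat.cast_natCast, ← Rat.cast_div, Rat.num_div_den]
  have hdpos : 0 < ‖((C.den : ℕ) : ℚ_[7])‖ := norm_pos_iff.mpr (by exact_mod_cast C.den_ne_zero)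
  have hC7' : ‖((C.num : ℤ) : ℚ_[7])‖ = ‖((C.den : ℕ) : ℚ_[7])‖ := by
    rw [hCq, norm_div, div_eq_one_iff_eq hdpos.ne'] at hC7
    exact hC7
  have hden : ¬ 7 ∣ C.den := fun h => by
    have hlt : ‖((C.den : ℕ) : ℚ_[7])‖ < 1 := Padic.norm_natCast_lt_one_iff.mpr h
    have hnumlt : ‖((C.num : ℤ) : ℚ_[7])‖ < 1 := by rw [hC7']; exact hlt
    have h7num : (7 : ℤ) ∣ C.num := Padic.norm_intCast_lt_one_iff.mp hnumlt
    have hg7 : (7 : ℕ) ∣ Nat.gcd C.num.natAbs C.den := Nat.dvd_gcd (Int.natAbs_dvd_natAbs.mpr h7num) h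
    rw [C.reduced] at hg7
    omega
  have hnum : ¬ (7 : ℤ) ∣ C.num := fun h => by
    have hlt : ‖((C.num : ℤ) : ℚ_[7])‖ < 1 := Padic.norm_intCast_lt_one_iff.mpr h
    have hden1 : ‖((C.den : ℕ) : ℚ_[7])‖ = 1 :=
      Padic.norm_natCast_eq_one_iff.mpr ((Nat.Prime.coprime_iff_not_dvd (by norm_num)).mpr hden)
    rw [hden1] at hC7'
    linarith
  refine ⟨tabFamily 7 T239 T239_ok, fun ℓ hℓ =>
    surjective_tabFamily 7 T239 T239_ok (Nat.prime_of_mem_primeFactors hℓ) (T239_surj ℓ hℓ), ?_⟩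
  exact kuriharaNumber_ne_zero_of_const D.f 7 239 (by norm_num) T239 T239_ok sigmaT C hnum hden
    (fun a ha hac => hCval a ha hac) kSumT_ne_zero

end Summit.BirchSwinnertonDyer.BirchSwinnertonDyer.Theorems.KolyvaginDepthDoor.MSymbolCert.Cert997c1

/-! ## §3 The row: both claims discharged -/

namespace Summit.BirchSwinnertonDyer.BirchSwinnertonDyer.Theorems.KolyvaginDepthDoor

open WeierstrassCurve NumberField IsDedekindDomain
open Summit.BirchSwinnertonDyer.BirchSwinnertonDyer.Theorems

namespace C997c1

/-- **THE TWIST-SIDE KURIHARA CLAIM OF ROW `997c1` @ `(7, −23)` FROM MODULARITY BY NAME** (the claim for `T₀` @ `(7, 239)`,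
the hypothesis `hunit` of `cruxBody_of_unit_239` VERBATIM), proved from `exists_isNewformOf`
(`MSymbolCert.Cert997c1.exists_kuriharaNumber_ne_zero_T0`, `N(T₀) = 527413`).
[cite: Kim2022StructureSelmer, §1.4.3] [cite: MazurTateTeitelbaum1986Invent, §I.8] -/
theorem kuriharaClaimT_7_239 (hnf : exists_isNewformOf) :
    haveI := minTwist23_isElliptic; haveI := minTwist23_isGloballyMinimal;
    haveI : NeZero ((((⟨0, -1, 1, -12872, -557532⟩ : WeierstrassCurve ℤ).map (Int.castRingHom ℚ))).conductorNorm ℤ) := neZero_conductorNorm_of_isElliptic _;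
    haveI := Fact.mk (by norm_num : Nat.Prime 7);
      ∀ (D : ModularParametrizationData (((⟨0, -1, 1, -12872, -557532⟩ : WeierstrassCurve ℤ).map (Int.castRingHom ℚ))) ((((⟨0, -1, 1, -12872, -557532⟩ : WeierstrassCurve ℤ).map (Int.castRingHom ℚ))).conductorNorm ℤ)),
      ¬ ((7 : ℕ) : ℤ) ∣ D.maninConstant →
      (∃ u : ℚ, ‖(u : ℚ_[7])‖ = 1 ∧ (((⟨0, -1, 1, -12872, -557532⟩ : WeierstrassCurve ℤ).map (Int.castRingHom ℚ))).realPeriodRat = u * plusPeriod D.f) →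
      ∃ ψ : (q : ℕ) → (ZMod q)ˣ →* Multiplicative (ZMod 7),
        (∀ q ∈ (239 : ℕ).primeFactors, Function.Surjective (ψ q)) ∧ kuriharaNumber D.f 7 239 ψ ≠ 0 := by
  intro D _ _
  haveI := minTwist23_isElliptic
  haveI : NeZero ((((⟨0, -1, 1, -12872, -557532⟩ : WeierstrassCurve ℤ).map (Int.castRingHom ℚ))).conductorNorm ℤ) := neZero_conductorNorm_of_isElliptic _
  exact MSymbolCert.Cert997c1.exists_kuriharaNumber_ne_zero_T0 hnf _ MSymbolCert.Cert997c1.conductorNorm_T0 D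

/-- **DEPTH-TABLE ROW `997c1`, `(p, d_K) = (7, −23)`, v28 — NO COMPUTATIONAL CLAIM LEFT.** For every imaginary quadratic
`K` with `d_K = −23`: granted Kim's Thm. 1.11 (`hKim`), modularity (`hnf`), Mazur's Cor. 4.1 (`hMaz`) and W. Zhang's
L8.4 (1)/9.1 (`h84`) BY NAME, the clause of the crux `KolyvaginDepthSupplyKN` holds at `W = 997c1` VERBATIM — g24's
`cruxBody_of_unit_239` with BOTH Kurihara claims PROVED (`kuriharaClaim_7_10277`: kernel-certified plus M-symbol of `997c1`, v27;
`kuriharaClaimT_7_239`: certified minus M-symbol and the twist formula, from `hnf`).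
CONDITIONAL on the four named print facts ONLY; per curve; nothing class-wide; BSD is not proved by it.
[cite: Kim2022StructureSelmer, Thm. 1.11 (PDF p. 8)] [cite: WZhang2014, Lemma 8.4 (1) (p. 236), Thm. 9.1 (p. 240)]
[cite: Mazur1978, Cor. 4.1] [cite: CremonaAlgorithms1997, Table 1 (997c1)] -/
theorem cruxBody_of_print_7_neg23
    (hKim : Kim2022_card_selmerGroup_le_pow_of_kuriharaNumber_ne_zero)
    (hnf : exists_isNewformOf) (hMaz : mazur_not_dvd_maninConstant_of_odd)
    (h84 : Literature.NumberTheory.EllipticCurves.WZhang2014_lemma84_exists_minimal_kolyvaginClass_one_selmerCard)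
    (K : Type) [Field K] [NumberField K] (hK : IsImaginaryQuadratic K) (hD : NumberField.discr K = -23) :
    haveI := isElliptic_c997c1; haveI := isGloballyMinimal_c997c1;
    ∃ (p : ℕ) (hp : Fact p.Prime), 5 ≤ p ∧ (((⟨0, -1, 1, -24, 54⟩ : WeierstrassCurve ℤ).map (Int.castRingHom ℚ))).HasGoodReductionAtPrime p ∧
      ¬ (p : ℤ) ∣ (((⟨0, -1, 1, -24, 54⟩ : WeierstrassCurve ℤ).map (Int.castRingHom ℚ))).frobeniusTrace p ∧
      (∀ n : ℕ, (((⟨0, -1, 1, -24, 54⟩ : WeierstrassCurve ℤ).map (Int.castRingHom ℚ))).HasSurjectiveModNGaloisRep (p ^ n : ℕ)) ∧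
      (∀ v : HeightOneSpectrum (𝓞 ℚ), (((⟨0, -1, 1, -24, 54⟩ : WeierstrassCurve ℤ).map (Int.castRingHom ℚ))).HasMultiplicativeReductionAt v →
        ¬ p ∣ (((⟨0, -1, 1, -24, 54⟩ : WeierstrassCurve ℤ).map (Int.castRingHom ℚ))).ordMinimalDiscriminant v) ∧
      ∃ (K : Type) (_ : Field K) (_ : NumberField K), IsImaginaryQuadratic K ∧
        NumberField.discr K ≠ -3 ∧ NumberField.discr K ≠ -4 ∧
        ∃ (_ : NeZero ((((⟨0, -1, 1, -24, 54⟩ : WeierstrassCurve ℤ).map (Int.castRingHom ℚ))).conductorNorm ℤ)),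
          SatisfiesHeegnerHypothesis ((((⟨0, -1, 1, -24, 54⟩ : WeierstrassCurve ℤ).map (Int.castRingHom ℚ))).conductorNorm ℤ) K ∧
        ∃ (Dt : ModularParametrizationData (((⟨0, -1, 1, -24, 54⟩ : WeierstrassCurve ℤ).map (Int.castRingHom ℚ))) ((((⟨0, -1, 1, -24, 54⟩ : WeierstrassCurve ℤ).map (Int.castRingHom ℚ))).conductorNorm ℤ))
          (β : ℤ) (ι : K →+* ℂ) (n₁ : ℕ) (d : KolyvaginHeegnerData Dt β ι n₁), Squarefree n₁ ∧
          (∀ q ∈ n₁.primeFactors, Zhang2014.IsKolyvaginPrime ((((⟨0, -1, 1, -24, 54⟩ : WeierstrassCurve ℤ).map (Int.castRingHom ℚ))).conductorNorm ℤ)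
            (((⟨0, -1, 1, -24, 54⟩ : WeierstrassCurve ℤ).map (Int.castRingHom ℚ))) K p q) ∧
          d.kolyvaginClass hp.out 1 ≠ 0 ∧
          (n₁.primeFactors.card + 1 ≤ (((⟨0, -1, 1, -24, 54⟩ : WeierstrassCurve ℤ).map (Int.castRingHom ℚ))).mordellWeilRank ∨
            (n₁.primeFactors.card ≤ (((⟨0, -1, 1, -24, 54⟩ : WeierstrassCurve ℤ).map (Int.castRingHom ℚ))).mordellWeilRank ∧
              n₁.primeFactors.card + 1 ≤ ((((⟨0, -1, 1, -24, 54⟩ : WeierstrassCurve ℤ).map (Int.castRingHom ℚ))).quadraticTwist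
                (NumberField.discr K : ℚ)).mordellWeilRank)) :=
  cruxBody_of_unit_239 hKim hnf hMaz h84 K hK hD kuriharaClaim_7_10277 (kuriharaClaimT_7_239 hnf)

end C997c1

end Summit.BirchSwinnertonDyer.BirchSwinnertonDyer.Theorems.KolyvaginDepthDoor

end
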